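import Literature.NumberTheory.LFunctions.SchoenfeldSieve
import HarnessLib

/-!
# Brent's range `[5·10⁷, 49·10⁸]` of Schoenfeld 1976, Cor. 1: a certified segmented sieve (the checker)

Topic: `Literature/NumberTheory/LFunctions`. The executable checker behind the discharge of the named
fact `Literature.NumberTheory.LFunctions.Schoenfeld1976_brentRange` (`SchoenfeldExplicit.lean`;
L. Schoenfeld, *Sharper bounds for the Chebyshev functions θ(x) and ψ(x). II*, Math. Comp. 30 (1976),
337–360, proof of Cor. 1, p. 340: "It follows from Table 1 of Brent [4] that for all primes
`p < 50·10⁸` we have `[li(p) + ½] − π(p) < 4612` … hence `|π(x) − li(x)| < 4613.5` for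
`5·10⁷ ≤ x ≤ 49·10⁸`"). The printed justification is R. P. Brent's table (Math. Comp. 29 (1975),
43–56, Table 1: `max {⟨L(p)⟩ − π(p)} = 4612` over the primes of `[2·10⁹, 5·10⁹]`, smaller maxima and
positive minima below); here the inequality is re-done *inside Lean* for every real `x` of the range,
by the cell method of the tree's `SchoenfeldSieve.lean` (which covers `[2659, 10⁸)` by trial
division), with the prime counts now coming from a segmented sieve of Eratosthenes on bit masks:

* **segments.** A segment is the `2²¹` integers `N+1, …, N+2L` above an even base `N`
  (`L = 2²⁰`); its odd members `N+1+2i` are the bits `i < L` of one natural number. For each odd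
  prime `p ≤ PMAX = 70600` the pattern `patR p` (bit `t < L` set iff `p ∣ t`, built by doubling,
  `patFrom`) is shifted to the first multiple of `p` in the segment (`firstIdx`) and OR-ed in
  (`sieveAcc`); the complement `surv` has bit `i` set iff `N+1+2i` is prime, as long as
  `PMAX < N` and `N + 2L ≤ PMAX²` (`testBit_surv_iff_prime`). The `6980` sieving primes are produced
  by the tree's trial division `SchoenfeldSieve.isPrimeF` (exact below `10⁸`).
* **counts.** Bits are counted by a `16`-bit table and halving (`popTable`, `popTree`,
  `rangeCount`); `primesIn S N a b = π(b−1) − π(a−1)` on a segment (sibling file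
  `SchoenfeldBrentSieveCount.lean`).
* **cells.** As in `SchoenfeldSieve.lean`: for real `x ∈ [a, b)`, `π(x) ∈ [π(a), π(b−1)]` and
  `li a ≤ li x ≤ li b`, so the integer checks (U) `2(liHi b − π(a)·2⁸⁰) < 9227·2⁸⁰` and
  (L) `2(π(b−1)·2⁸⁰ − liLo a) < 9227·2⁸⁰` give `|π(x) − li(x)| < 4613.5` on the cell; `li` by
  Ramanujan's series in fixed point with `88` terms (`liHiN`, `liLoN`, the tree's `goHi`/`goLo`);
  cells are chosen adaptively with halving retries (`tryCell`, `segCells`). The bound is tight: the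
  true supremum of `li(x) − π(x)` on the range lies in `[4612.5, 4613.5)` by Brent's table, and the
  checker isolates unit cells `[p−1, p)` at the record primes by itself.
* **blocks.** `checkChunk N m cIn cOut` runs `m` segments from `N` with the claimed count
  `π(N) = cIn`; `24` blocks of `97` segments, `SchoenfeldBrentSieve/Chunk00–23.lean` (one
  `native_decide` each, declared `computational`, `≈ 60 s` each), chained from `π(49999998) = 3001134`
  (the tree's `SchoenfeldSieve.SegOK 50000000 3001134`) in the assembly file.

This file: the checker (all `def`s are the computable functions) and the first part of its
soundness (the sieving primes, bit semantics of the patterns, the first hit). The survivor mask,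
the counts and `li` are treated in `SchoenfeldBrentSieveCount.lean` / `SchoenfeldBrentSieveSound.lean`.
Nothing here uses the Riemann hypothesis; everything is proved from the standard axioms.

## References

* L. Schoenfeld, Math. Comp. 30 (1976), 337–360, proof of Cor. 1 (p. 340). [Schoenfeld1976]
* R. P. Brent, *Irregularities in the distribution of primes and twin primes*, Math. Comp. 29
  (1975), 43–56, Table 1 and (1.13). [Brent1975]
-/

open Literature.Analysis.SpecialFunctions.KernelLog
open Literature.Analysis.ValidatedNumerics.Numerics (cdiv)

namespace Literature.NumberTheory.LFunctions

namespace BrentSieve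

open SchoenfeldSieve SchoenfeldNumerics PrimeTable

/-! ## The executable checker (definitions only; soundness is proved below / in the sibling file) -/

/-- Slots per segment: `L = 2²⁰` odd numbers, so a segment is `2²¹` consecutive integers. [folklore] -/
def L : ℕ := 1048576

/-- The all-ones mask `2^L − 1`. [folklore] -/
def allOnes : ℕ := 2 ^ L - 1

/-- `allOnes = 2^L − 1` (recorded before `allOnes` is made irreducible: unfolding it lets `whnf`
evaluate `2^L` by repeated multiplication). [folklore] -/
theorem allOnes_eq : allOnes = 2 ^ L - 1 := rfl

attribute [irreducible] allOnes

/-- Sieving bound: all odd primes `p ≤ PMAX` are used, so the sieve is exact below `PMAX² ≈ 4.98·10⁹`.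
[folklore] -/
def PMAX : ℕ := 70600

/-- The odd primes `3 ≤ p ≤ PMAX`, by the tree's trial division `SchoenfeldSieve.isPrimeF` (exact below
`10⁸`, `isPrimeF_iff`). [folklore] -/
@[irreducible] def sievePrimes : List ℕ :=
  (List.range' 3 (PMAX - 2)).filter fun n ↦ n % 2 == 1 && isPrimeF n

/-- The first slot hit by `p` in the segment based at `N`: the least `i ≥ 0` with `p ∣ N + 1 + 2i`
(`p` odd; `(p+1)/2` is the inverse of `2` modulo `p`). [folklore] -/
def firstIdx (N p : ℕ) : ℕ := ((p - (N + 1) % p) * ((p + 1) / 2)) % p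

/-- Doubling: from a pattern `P` of period `s` build `P ||| P <<< s ||| …` until the period reaches `L`.
[folklore] -/
def patFrom (P s : ℕ) : ℕ → ℕ
  | 0 => P
  | f + 1 => if L ≤ s then P else patFrom (P ||| (P <<< s)) (2 * s) f

/-- The multiples-of-`p` pattern on one segment: bit `t < L` is set iff `p ∣ t`. [folklore] -/
def patR (p : ℕ) : ℕ := patFrom 1 p 22 &&& allOnes

/-- The sieving primes paired with their patterns (computed once per process). [folklore] -/
@[irreducible] def pats : List (ℕ × ℕ) := sievePrimes.map fun p ↦ (p, patR p)

/-- OR of the shifted patterns: bit `i` of the result is set iff some listed `p` divides `N + 1 + 2i`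
(for `i < L`; higher bits are garbage). [folklore] -/
def sieveAcc (N : ℕ) : List (ℕ × ℕ) → ℕ → ℕ
  | [], acc => acc
  | pr :: prs, acc => sieveAcc N prs (acc ||| (pr.2 <<< firstIdx N pr.1))

/-- The survivor mask of the segment based at the even number `N`: bit `i < L` is set iff no listed
prime divides `N + 1 + 2i`, i.e. (for `PMAX < N`, `N + 2L < PMAX²`) iff `N + 1 + 2i` is prime. [folklore] -/
def surv (prs : List (ℕ × ℕ)) (N : ℕ) : ℕ := allOnes ^^^ (sieveAcc N prs 0 &&& allOnes)

/-- Reference bit count: `bitSum n x = #{i < n | bit i of x}`. [folklore] -/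
def bitSum : ℕ → ℕ → ℕ
  | 0, _ => 0
  | n + 1, x => bitSum n x + (x >>> n) % 2

/-- Table of the bit counts of all `16`-bit numbers (computed once per process). [folklore] -/
def popTable : Array ℕ := Array.ofFn (n := 65536) fun i ↦ bitSum 16 i.val

/-- Bit count of a `64`-bit number by four table look-ups. [folklore] -/
def pop64 (y : ℕ) : ℕ :=
  popTable[y &&& (2 ^ 16 - 1)]?.getD 0 + popTable[(y >>> 16) &&& (2 ^ 16 - 1)]?.getD 0 +
    popTable[(y >>> 32) &&& (2 ^ 16 - 1)]?.getD 0 + popTable[(y >>> 48) &&& (2 ^ 16 - 1)]?.getD 0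

/-- Bit count of `y < 2^(64·2^k)` by halving. [folklore] -/
def popTree : ℕ → ℕ → ℕ
  | 0, y => pop64 y
  | k + 1, y => popTree k (y &&& (2 ^ (64 * 2 ^ k) - 1)) + popTree k (y >>> (64 * 2 ^ k))

/-- The least `k ≤ 14` with `w ≤ 64·2^k` (`depthGo w fuel k c`, `c = 64·2^k`). [folklore] -/
def depthGo (w : ℕ) : ℕ → ℕ → ℕ → ℕ
  | 0, k, _ => k
  | fuel + 1, k, c => if w ≤ c then k else depthGo w fuel (k + 1) (2 * c)

/-- Number of set bits of `x` in positions `[j, j + w)` (`w ≤ L`). [folklore] -/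
def rangeCount (x j w : ℕ) : ℕ := popTree (depthGo w 14 0 64) ((x >>> j) &&& (2 ^ w - 1))

/-- Is `N + r` prime (`1 ≤ r ≤ 2L`)? Read off the survivor mask `S` of the segment at the even base `N`:
`N + r` is odd iff `r` is, and then it is the slot `r / 2`. (Positions are kept *relative* to `N`:
comparing absolute positions `N + c` symbolically is slow in definitional unfolding.) [folklore] -/
def isPrimeR (S r : ℕ) : Bool := r % 2 == 1 && (S >>> (r / 2)) % 2 == 1

/-- Number of primes among `N + r₁, …, N + r₂ − 1` (`1 ≤ r₁ ≤ r₂ ≤ 2L + 1`), from the survivor mask: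
the slots `i` with `r₁ ≤ 1 + 2i < r₂` are `[r₁/2, r₂/2)`. [folklore] -/
def primesInR (S r₁ r₂ : ℕ) : ℕ := rangeCount S (r₁ / 2) (r₂ / 2 - r₁ / 2)

/-- Number of terms of Ramanujan's series used for `li` (tail `< 10⁻⁸` below `5·10⁹`). [folklore] -/
def NTB : ℕ := 88

/-- `seriesHiN n u`: upper fixed-point partial sum with `n` terms and the next term (cf.
`SchoenfeldSieve.seriesHi`, which is the case `n = 75`). [folklore] -/
def seriesHiN (n : ℕ) (u : ℤ) : ℤ × ℤ :=
  let r := goHi u n 1 SC 0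
  (r.1, cdiv (r.2 * u) (((n : ℤ) + 1) * SC))

/-- `seriesLoN n l`: lower fixed-point partial sum with `n` terms (cf. `SchoenfeldSieve.seriesLo`). [folklore] -/
def seriesLoN (n : ℕ) (l : ℤ) : ℤ := goLo l n 1 SC 0

/-- `liHiN n x ≥ 2⁸⁰ li x` with `n` series terms (cf. `SchoenfeldSieve.liHi`). [folklore] -/
def liHiN (n x : ℕ) : Option ℤ :=
  match logIv x with
  | some (_, Lhi) =>
      match loglogHi Lhi with
      | some ll =>
          let s := seriesHiN n Lhi
          some (GHI + ll + s.1 + (x : ℤ) * cdiv s.2 ((n : ℤ) + 1))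
      | none => none
  | none => none

/-- `liLoN n x ≤ 2⁸⁰ li x` with `n` series terms (cf. `SchoenfeldSieve.liLo`). [folklore] -/
def liLoN (n x : ℕ) : Option ℤ :=
  match logIv x with
  | some (Llo, _) =>
      match loglogLo Llo with
      | some ll => some (GLO + ll + seriesLoN n Llo)
      | none => none
  | none => none

/-- Twice the bound of the fact: `2 · 4613.5 = 9227`. [cite: Schoenfeld1976, proof of Cor. 1 (p. 340)] -/
def B2 : ℤ := 9227

/-- **One cell with retries.** `tryCell S N r pia llA fuel h` (positions relative to the even base
`N`, `a = N + r`): with `pia = π(a)`, `llA = liLoN a`, try the cell `[a, b)`, `b = N + r'`,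
`r' = min (2L+1) (r + max 1 h)`: `pib = π(b − 1) = π(a) + #{primes in [a+1, b)}` from the mask,
`lhB = liHiN b`, and test (U) `2 (lhB − π(a)·2⁸⁰) < 9227·2⁸⁰`, (L) `2 (π(b−1)·2⁸⁰ − llA) < 9227·2⁸⁰`;
on failure retry with `h/2`. Returns `(r', π(b − 1))`. [folklore] -/
def tryCell (S N r pia : ℕ) (llA : ℤ) : ℕ → ℕ → Option (ℕ × ℕ)
  | 0, _ => none
  | fuel + 1, h =>
      let r' := min (2 * L + 1) (r + max 1 h)
      let pib := pia + primesInR S (r + 1) r'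
      match liHiN NTB (N + r') with
      | some lhB =>
          if 2 * (lhB - (pia : ℤ) * SC) < B2 * SC ∧ 2 * ((pib : ℤ) * SC - llA) < B2 * SC then
            some (r', pib)
          else tryCell S N r pia llA fuel (h / 2)
      | none => none

/-- **The cell loop of one segment** `N + 1, …, N + 2L`: `segCells S N fuel r cnt` with
`cnt = π(N + r − 1)` returns `π(N + 2L)`; the cell length is guessed as `20 ×` the upper slack at
`N + r` (a heuristic with no bearing on soundness). [folklore] -/
def segCells (S N : ℕ) : ℕ → ℕ → ℕ → Option ℕ
  | 0, r, cnt => if 2 * L + 1 ≤ r then some cnt else none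
  | fuel + 1, r, cnt =>
      if 2 * L + 1 ≤ r then some cnt else
      let pia := if isPrimeR S r then cnt + 1 else cnt
      match liLoN NTB (N + r) with
      | some llA =>
          let h := ((B2 * SC - 2 * (llA - (pia : ℤ) * SC)) * 10 / SC).toNat
          match tryCell S N r pia llA 40 h with
          | some (r', pib) => segCells S N fuel r' pib
          | none => none
      | none => none

/-- **The segment loop of one block**: `chunkSegs prs m N cnt` with `cnt = π(N)` sieves the `m` segments
based at `N, N + 2L, …` and returns `π(N + 2Lm)`. [folklore] -/
def chunkSegs (prs : List (ℕ × ℕ)) : ℕ → ℕ → ℕ → Option ℕ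
  | 0, _, cnt => some cnt
  | m + 1, N, cnt =>
      match segCells (surv prs N) N (2 * L + 1) 1 cnt with
      | some c' => chunkSegs prs m (N + 2 * L) c'
      | none => none

/-- **The block check**: `checkChunk N m cIn cOut = true` iff the `m` segments from the even base `N`,
entered with `π(N) = cIn` (claimed), pass every cell check and end with the count `cOut`. [folklore] -/
def checkChunk (N m cIn cOut : ℕ) : Bool := chunkSegs pats m N cIn == some cOut

/-! ## Soundness of the sieve -/

section Soundness

/-! ### The sieving primes -/

/-- Membership in `sievePrimes`: exactly the odd primes `3 ≤ p ≤ PMAX`. [folklore] -/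
theorem mem_sievePrimes {p : ℕ} : p ∈ sievePrimes ↔ 3 ≤ p ∧ p ≤ PMAX ∧ p % 2 = 1 ∧ p.Prime := by
  unfold sievePrimes
  rw [List.mem_filter, List.mem_range'_1, Bool.and_eq_true, beq_iff_eq]
  constructor
  · rintro ⟨⟨h1, h2⟩, h3, h4⟩
    exact ⟨h1, by unfold PMAX at h2 ⊢; omega, h3, (isPrimeF_iff (by unfold PMAX at h2; omega)).1 h4⟩
  · rintro ⟨h1, h2, h3, h4⟩
    exact ⟨⟨h1, by unfold PMAX at h2 ⊢; omega⟩, h3, (isPrimeF_iff (by unfold PMAX at h2; omega)).2 h4⟩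

/-! ### The patterns -/

/-- The period reached by the doubling `patFrom · s fuel`. [folklore] -/
def perFrom (s : ℕ) : ℕ → ℕ
  | 0 => s
  | f + 1 => if L ≤ s then s else perFrom (2 * s) f

/-- `s ∣ perFrom s f`. [folklore] -/
theorem dvd_perFrom : ∀ (f s : ℕ), s ∣ perFrom s f
  | 0, s => by simp [perFrom]
  | f + 1, s => by
      unfold perFrom
      split_ifs
      · exact dvd_rfl
      · exact dvd_trans (Dvd.intro 2 (by ring)) (dvd_perFrom f (2 * s))

/-- With enough fuel the period reaches `L`: `L ≤ 2^f·s → L ≤ perFrom s f`. [folklore] -/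
theorem le_perFrom : ∀ (f s : ℕ), L ≤ 2 ^ f * s → L ≤ perFrom s f
  | 0, s, h => by simpa [perFrom] using h
  | f + 1, s, h => by
      unfold perFrom
      split_ifs with hs
      · exact hs
      · exact le_perFrom f (2 * s) (by rw [pow_succ] at h; linarith)

/-- **Bit semantics of the doubling**: if bit `i` of `P` is set iff `p ∣ i ∧ i < s` (`p ∣ s`), then
bit `i` of `patFrom P s f` is set iff `p ∣ i ∧ i < perFrom s f`. [folklore] -/
theorem testBit_patFrom {p : ℕ} : ∀ (f : ℕ) (P s : ℕ), p ∣ s →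
    (∀ i, P.testBit i = true ↔ p ∣ i ∧ i < s) →
    ∀ i, (patFrom P s f).testBit i = true ↔ p ∣ i ∧ i < perFrom s f
  | 0, P, s, _, hP, i => by simpa [patFrom, perFrom] using hP i
  | f + 1, P, s, hs, hP, i => by
      unfold patFrom perFrom
      split_ifs with hL
      · exact hP i
      · refine testBit_patFrom f _ (2 * s) (dvd_mul_of_dvd_right hs 2) (fun j ↦ ?_) i
        rw [Nat.testBit_or, Bool.or_eq_true, Nat.testBit_shiftLeft, Bool.and_eq_true,
          decide_eq_true_eq, hP, hP]
        constructor
        · rintro (⟨h1, h2⟩ | ⟨h1, h2, h3⟩)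
          · exact ⟨h1, by omega⟩
          · refine ⟨?_, by omega⟩
            have e : j = (j - s) + s := by omega
            rw [e]
            exact dvd_add h2 hs
        · rintro ⟨h1, h2⟩
          by_cases hj : j < s
          · exact Or.inl ⟨h1, hj⟩
          · exact Or.inr ⟨by omega, Nat.dvd_sub h1 hs, by omega⟩

/-- Bit `i` of `allOnes` is set iff `i < L`. [folklore] -/
theorem testBit_allOnes (i : ℕ) : allOnes.testBit i = decide (i < L) := by
  rw [allOnes_eq, Nat.testBit_two_pow_sub_one]

/-- **The pattern**: for `1 ≤ p`, bit `t` of `patR p` is set iff `t < L ∧ p ∣ t`. [folklore] -/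
theorem testBit_patR {p : ℕ} (hp : 1 ≤ p) (t : ℕ) : (patR p).testBit t = true ↔ t < L ∧ p ∣ t := by
  unfold patR
  rw [Nat.testBit_and, Bool.and_eq_true, testBit_allOnes, decide_eq_true_eq]
  have h1 : ∀ i, (1 : ℕ).testBit i = true ↔ p ∣ i ∧ i < p := by
    intro i
    rw [show (1 : ℕ) = 2 ^ 0 from rfl, Nat.testBit_two_pow]
    simp only [decide_eq_true_eq]
    constructor
    · rintro rfl; exact ⟨dvd_zero p, hp⟩
    · rintro ⟨h, hi⟩
      exact (Nat.eq_zero_of_dvd_of_lt h hi).symm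
  rw [testBit_patFrom 22 1 p dvd_rfl h1 t]
  have hL : L ≤ perFrom p 22 := le_perFrom 22 p (by unfold L; omega)
  constructor
  · rintro ⟨⟨h1, _⟩, h3⟩; exact ⟨h3, h1⟩
  · rintro ⟨h1, h2⟩; exact ⟨⟨h2, lt_of_lt_of_le h1 hL⟩, h1⟩

/-! ### The first hit -/

/-- `firstIdx N p < p` (`1 ≤ p`). [folklore] -/
theorem firstIdx_lt {N p : ℕ} (hp : 1 ≤ p) : firstIdx N p < p := Nat.mod_lt _ hp

/-- **The first hit is a hit**: `p ∣ N + 1 + 2·firstIdx N p` for odd `p`. [folklore] -/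
theorem dvd_firstIdx (N : ℕ) {p : ℕ} (hp : p % 2 = 1) : p ∣ N + 1 + 2 * firstIdx N p := by
  unfold firstIdx
  have hp0 : 0 < p := by omega
  set r := (N + 1) % p with hr
  set m := (p - r) * ((p + 1) / 2) with hm
  have hrp : r ≤ p := (Nat.mod_lt _ hp0).le
  have h2 : 2 * ((p + 1) / 2) = p + 1 := by omega
  have h2m : 2 * m = (p - r) * p + (p - r) := by
    rw [hm, mul_left_comm, h2]; ring
  have hA : N + 1 ≡ r [MOD p] := (Nat.mod_modEq (N + 1) p).symm
  have hB : 2 * (m % p) ≡ 2 * m [MOD p] := (Nat.mod_modEq m p).mul_left 2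
  have hC : (p - r) * p + (p - r) ≡ 0 + (p - r) [MOD p] :=
    (Nat.modEq_zero_iff_dvd.2 (dvd_mul_left p (p - r))).add_right _
  have hD : N + 1 + 2 * (m % p) ≡ r + (p - r) [MOD p] := by
    refine hA.add (hB.trans ?_)
    rw [h2m]
    rw [zero_add] at hC
    exact hC
  rw [show r + (p - r) = p by omega] at hD
  exact (Nat.modEq_zero_iff_dvd.1 (hD.trans (Nat.modEq_zero_iff_dvd.2 dvd_rfl)))

/-- **Hits are the residue class of the first hit**: for odd `p` and any `i`,
`p ∣ N + 1 + 2i ↔ firstIdx N p ≤ i ∧ p ∣ i − firstIdx N p`. [folklore] -/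
theorem dvd_iff_firstIdx (N : ℕ) {p : ℕ} (hp : p % 2 = 1) (i : ℕ) :
    p ∣ N + 1 + 2 * i ↔ firstIdx N p ≤ i ∧ p ∣ i - firstIdx N p := by
  have h0 := dvd_firstIdx N hp
  have hlt := firstIdx_lt (N := N) (p := p) (by omega)
  set i0 := firstIdx N p
  have hcop : Nat.Coprime p 2 := by
    rw [Nat.coprime_comm, Nat.coprime_two_left]
    exact Nat.odd_iff.2 hp
  constructor
  · intro h
    by_cases hi : i0 ≤ i
    · refine ⟨hi, ?_⟩
      have e : N + 1 + 2 * i = (N + 1 + 2 * i0) + 2 * (i - i0) := by omega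
      rw [e] at h
      have h2 : p ∣ 2 * (i - i0) := (Nat.dvd_add_right h0).1 h
      exact hcop.dvd_of_dvd_mul_left h2
    · exfalso
      have hi' : i < i0 := not_le.1 hi
      have e : N + 1 + 2 * i0 = (N + 1 + 2 * i) + 2 * (i0 - i) := by omega
      rw [e] at h0
      have h2 : p ∣ 2 * (i0 - i) := (Nat.dvd_add_right h).1 h0
      have h3 : p ∣ i0 - i := hcop.dvd_of_dvd_mul_left h2
      have := Nat.le_of_dvd (by omega) h3
      omega
  · rintro ⟨hi, hd⟩
    have e : N + 1 + 2 * i = (N + 1 + 2 * i0) + 2 * (i - i0) := by omega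
    rw [e]
    exact dvd_add h0 (dvd_mul_of_dvd_right hd 2)

end Soundness

end BrentSieve

end Literature.NumberTheory.LFunctions
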